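import Mathlib
import HarnessLib
import Literature.MathematicalPhysics.StatisticalMechanics.WeightedNormBounds
import Literature.MathematicalPhysics.StatisticalMechanics.WeightTower
import Literature.MathematicalPhysics.StatisticalMechanics.GradientFieldNorms
import Literature.MathematicalPhysics.StatisticalMechanics.RelevantHamiltonianNorm
import Literature.MathematicalPhysics.StatisticalMechanics.TorusNeighbourhoods
import Literature.MathematicalPhysics.StatisticalMechanics.PolymerExpansion
import Literature.Barriers.CriticalPhenomena.RigorousRGSmallParameterPolymers

/-!
# The norms of the gradient renormalisation group as predicates: `‖K‖_k^{(A)} ≤ C`,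
# `‖K‖_{k:k+1}^{(A)} ≤ C` ([ABKM19] (6.47)–(6.50))

[ABKM19] measure a polymer functional `K ∈ M(𝓟_k^c)` by the global weak norm
`‖K‖_k^{(A)} = sup_{X ∈ 𝓟_k^c} A^{|X|_k} sup_φ |K(X)|_{k,X,T_φ} / w_k^X(φ)` ((6.48), (6.50)) and its
`k:k+1` variant with the weight `w_{k:k+1}^X` ((6.49)); relevant Hamiltonians by `‖H‖_{k,0}`
((6.51), `hamNorm`).  Following the tree's convention (`WeightedNormBounds.TayNormLE`: bounds as
predicates, no suprema, no Banach spaces) we define the global norms as PREDICATES on `K` and a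
constant `C`:

* `NormParams` — the scale-indexed parameters: gauge weights `𝔥_k`, `R_k = L^k`, gauge order `p`,
  Taylor order `r₀`, small-set radius `rad k` (the `starRad` of `WeightDataABKM`), the base `L`,
  the large-set parameter `A`, and the weight tower `W` (`WeightData`, Ch. 7);
* **`WeakNormLE P k K C`** — `‖K‖_k^{(A)} ≤ C`: for every non-empty connected `k`-polymer `X`,
  `TayNormLE (T_k^{X*}) r₀ (w_k^X) (K X) (C · A^{−|X|_k})`;
* **`MidNormLE P k K C`** — the same with `w_{k:k+1}^X` (`‖K‖_{k:k+1}^{(A)} ≤ C`);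
* monotonicity in `C`, the pointwise consequence `‖K(X, φ)‖ ≤ C A^{−|X|_k} w_k^X(φ)`
  (`WeakNormLE.norm_apply_le`), `WeakNormLE.add`, and the zero functional.

Definitions and bookkeeping only; the estimates of Ch. 9–10 are stated in these terms elsewhere.
Connectedness is the tree's `LongRangePhi4.Polymer.IsConn` (`ℓ^∞`-adjacency), `|X|_k` is
`TorusPolymer.numBlocks`, `X*` is `TorusPolymer.thicken (rad k) X`.

## References
* S. Adams, S. Buchholz, R. Kotecký, S. Müller, arXiv:1910.13564, Ch. 6.4 (6.47)–(6.51)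
  [AdamsBuchholzKoteckyMuller2019].
-/

noncomputable section

namespace Literature.MathematicalPhysics.StatisticalMechanics.GradientRG

open scoped BigOperators Classical
open Finset
open Literature.MathematicalPhysics.StatisticalMechanics.TorusPolymer (IsPolymer numBlocks thicken)
open Literature.Barriers.CriticalPhenomena.LongRangePhi4.Polymer (IsConn)

variable {d M : ℕ} [NeZero M]

/-- **The parameters of the norms** at all scales: gauge weights `𝔥 k` (`h_k L^{−k(d−2)/2}`) and
`R k` (`L^k`), gauge order `p` (`p_Φ`), Taylor order `r₀`, small-set radius `rad k` (`X* = X +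
[−rad k, rad k]^d`), base `L`, large-set parameter `A`, and the weight tower `W` of Ch. 7.
[cite: AdamsBuchholzKoteckyMuller2019, Ch. 6.4 (6.40)–(6.50)] -/
structure NormParams (d M : ℕ) [NeZero M] where
  /-- gauge weight `𝔥_k` -/
  𝔥 : ℕ → ℝ
  /-- gauge length `R_k = L^k` -/
  R : ℕ → ℝ
  /-- gauge order `p_Φ` -/
  p : ℕ
  /-- Taylor order `r₀` -/
  r₀ : ℕ
  /-- radius of the small-set neighbourhood `X*` at scale `k` -/
  rad : ℕ → ℕ
  /-- the base `L` (block side `L^k` at scale `k`) -/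
  L : ℕ
  /-- the large-set parameter `A ≥ 1` of (6.50) -/
  A : ℝ
  /-- the weight tower `w_k^X`, `w_{k:k+1}^X` of Theorem 7.1 -/
  W : WeightData (Fin d → ZMod M)

namespace NormParams

variable (P : NormParams d M)

/-- The gauge `T_k^{X*}` of the norm `|·|_{k,X,T_φ}` ((6.40)–(6.41), (6.47)).
[cite: AdamsBuchholzKoteckyMuller2019, Ch. 6.4 (6.47)] -/
def gauge (k : ℕ) (X : Finset (Fin d → ZMod M)) :
    ((Fin d → ZMod M) → ℝ) →ₗ[ℝ] (↥(thicken (P.rad k) X) × ↥(diffIndex d P.p) → ℝ) :=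
  fieldGauge (P.𝔥 k) (P.R k) P.p (thicken (P.rad k) X)

/-- The large-set factor `A^{−|X|_k}`. [cite: AdamsBuchholzKoteckyMuller2019, Ch. 6.4 (6.50)] -/
def aFactor (k : ℕ) (X : Finset (Fin d → ZMod M)) : ℝ := (P.A ^ numBlocks (P.L ^ k) X)⁻¹

end NormParams

/-- **`‖K‖_k^{(A)} ≤ C`** ((6.48), (6.50)) as a predicate: for every non-empty connected `k`-polymer
`X`, `|K(X)|_{k,X,T_φ} ≤ C A^{−|X|_k} w_k^X(φ)` for all `φ`.
[cite: AdamsBuchholzKoteckyMuller2019, Ch. 6.4 (6.50)] -/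
def WeakNormLE (P : NormParams d M) (k : ℕ) (K : Finset (Fin d → ZMod M) → ((Fin d → ZMod M) → ℝ) → ℂ)
    (C : ℝ) : Prop :=
  ∀ X : Finset (Fin d → ZMod M), IsPolymer (P.L ^ k) X → IsConn X →
    TayNormLE (P.gauge k X) P.r₀ (P.W.weight k X) (K X) (C * P.aFactor k X)

/-- **`‖K‖_{k:k+1}^{(A)} ≤ C`** ((6.49)–(6.50)): the same with the intermediate weight `w_{k:k+1}^X`.
[cite: AdamsBuchholzKoteckyMuller2019, Ch. 6.4 (6.49)] -/
def MidNormLE (P : NormParams d M) (k : ℕ) (K : Finset (Fin d → ZMod M) → ((Fin d → ZMod M) → ℝ) → ℂ)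
    (C : ℝ) : Prop :=
  ∀ X : Finset (Fin d → ZMod M), IsPolymer (P.L ^ k) X → IsConn X →
    TayNormLE (P.gauge k X) P.r₀ (P.W.midWeight k X) (K X) (C * P.aFactor k X)

namespace WeakNormLE

variable {P : NormParams d M} {k : ℕ} {K K' : Finset (Fin d → ZMod M) → ((Fin d → ZMod M) → ℝ) → ℂ}
  {C C' : ℝ}

/-- The large-set factor is positive for `A > 0`. [cite: AdamsBuchholzKoteckyMuller2019, Ch. 6.4 (6.50)] -/
theorem aFactor_pos (hA : 0 < P.A) (k : ℕ) (X : Finset (Fin d → ZMod M)) : 0 < P.aFactor k X := by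
  unfold NormParams.aFactor; positivity

/-- Monotonicity in the constant (`A > 0`; weights are positive).
[cite: AdamsBuchholzKoteckyMuller2019, Ch. 6.4 (6.50)] -/
theorem mono (h : WeakNormLE P k K C) (hA : 0 < P.A) (hCC' : C ≤ C') : WeakNormLE P k K C' :=
  fun X hX hc => (h X hX hc).mono (mul_le_mul_of_nonneg_right hCC' (aFactor_pos hA k X).le)
    fun _ => (Real.exp_pos _).le

/-- **Pointwise bound**: `‖K(X, φ)‖ ≤ C A^{−|X|_k} w_k^X(φ)` for gauge-local `K(X, ·)` on a connected
`k`-polymer. [cite: AdamsBuchholzKoteckyMuller2019, Ch. 6.4 (6.48)] -/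
theorem norm_apply_le (h : WeakNormLE P k K C) {X : Finset (Fin d → ZMod M)} (hX : IsPolymer (P.L ^ k) X)
    (hc : IsConn X) (hloc : IsGaugeLocal (P.gauge k X) (K X)) (φ : (Fin d → ZMod M) → ℝ) :
    ‖K X φ‖ ≤ C * P.aFactor k X * P.W.weight k X φ :=
  (h X hX hc).norm_apply_le hloc φ

/-- Additivity: `‖K + K'‖ ≤ ‖K‖ + ‖K'‖` (for `C^{r₀}` functionals).
[cite: AdamsBuchholzKoteckyMuller2019, Ch. 6.4 (6.50)] -/
theorem add (h : WeakNormLE P k K C) (h' : WeakNormLE P k K' C')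
    (hK : ∀ X, ContDiff ℝ P.r₀ (K X)) (hK' : ∀ X, ContDiff ℝ P.r₀ (K' X)) :
    WeakNormLE P k (fun X => K X + K' X) (C + C') := fun X hX hc => by
  have := (h X hX hc).add (h' X hX hc) (hK X) (hK' X)
  simpa [add_mul] using this

/-- The zero functional has norm `≤ 0`. [cite: AdamsBuchholzKoteckyMuller2019, Ch. 6.4 (6.50)] -/
theorem zero : WeakNormLE P k (fun _ _ => 0) 0 := fun X _ _ φ => by
  rw [zero_mul, zero_mul, tayNorm_const]
  simp

end WeakNormLE

namespace MidNormLE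

variable {P : NormParams d M} {k : ℕ} {K : Finset (Fin d → ZMod M) → ((Fin d → ZMod M) → ℝ) → ℂ} {C C' : ℝ}

/-- Monotonicity in the constant. [cite: AdamsBuchholzKoteckyMuller2019, Ch. 6.4 (6.49)] -/
theorem mono (h : MidNormLE P k K C) (hA : 0 < P.A) (hCC' : C ≤ C') : MidNormLE P k K C' :=
  fun X hX hc => (h X hX hc).mono (mul_le_mul_of_nonneg_right hCC' (WeakNormLE.aFactor_pos hA k X).le)
    fun _ => (Real.exp_pos _).le

end MidNormLE

end Literature.MathematicalPhysics.StatisticalMechanics.GradientRG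

end
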